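import Mathlib
import Summits.Ventures.HodgeRepro2.LiuOscillator

/-!
# T6B5OrbitHyp — Tier 6, sub-goal B5: the displayed sentence FOLLOWING Liu's Corollary 4.20 (orbit-invariance of d(μ, K))

One display, a `def … : Prop` in the free parameter `S : Liu.AlbaneseH1Shape K c χEF` (p2's accepted abstract datum
of Liu §4.2–§4.3, the same datum over which t6-p6's `T6B3Hyp.lean` displays Prop. 4.13 / Thm. 4.18 / Cor. 4.20):
the SENTENCE FOLLOWING Corollary 4.20 (p. 55 ll. 18–19; outside the corollary environment in the author's source,
arXiv:2102.11518v2 l. 2314, between `\end{corollary}` and `\begin{proof}`), «It is clear that the integer d(μ, K)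
depends only on the Gal(C/Q)-orbit of μ.» — the author's unnumbered upright remark between the corollary's last words
«… ε is μ-admissible.» (l. 17) and «Proof. This is a direct consequence of Theorem 4.18.» (l. 20): asserted in print,
not a numbered statement and not covered by that proof sentence (t6-lit card C63 (a) / QA-t6lit-87, locator finding
F19). t6-p6's display `Hyp.Liu2021_Cor4_20` (= p2's `Liu.LiuCor420Shape`) marks this sentence as not recorded. It is
the printed input of TIER4 §B5 Theorem B5.1(v) (Step 6 [C]); `T6B5Orbit.lean` consumes it. Statement lane: definition
and `#check` only. Journal page layer `paper:liu2021-fourier-jacobi-cycles-arithmetic-relative-trace-formula`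
(Y. Liu, Cambridge J. Math. 9 (2021), no. 1, 1–147; `p00NN` = journal page NN, `l.` = layer line).
v2 (2026-08-26, gen 5) = p411620 with the docstrings re-cited per F19; the `def` is byte-identical to p411620.
README §8(d): uses an L-value-free non-vanishing device: NO.
-/

namespace Summit.Ventures.HodgeRepro2.T6.Hyp

open Summit.Ventures.HodgeRepro2.ShimuraData

universe u

variable {K : Type u} [Field K] [NumberField K] [NumberField.IsCMField K] {c : Liu.IdeleConjugation K}
  {χEF : Liu.QuadraticCharacter K c}

/-- [cite: Liu2021, Cambridge J. Math. 9 (2021) 1–147, the sentence following Corollary 4.20 (p. 55 ll. 18–19; outside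
the corollary environment in the author's source, arXiv:2102.11518v2 l. 2314 — an asserted remark, not a numbered
statement), quoted with the definition of d(μ, K) that precedes it inside the corollary (p. 55 ll. 10–17), layer
paper:liu2021-fourier-jacobi-cycles-arithmetic-relative-trace-formula p0055 ll. 10–19] «and» ‹d(μ, K) := Σ_ε Σ_χ
dim_C ω(μ, ε, χ)^K,› (the display, layer ll. 10–16 exploded in reading order: «dimC ω(μ, ε, χ)K ,» l. 10,
«d(μ, K) :=» l. 12, «ε» l. 13, «χ» l. 15; the Σ signs are not printed by the layer)
«where the sum is taken over all ε, χ such that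
ε is μ-admissible.
It is clear that the integer d(μ, K) depends only on the Gal(C/Q)-orbit
of μ.» (layer ll. 17–19: l. 17 = the corollary's last words, ll. 18–19 = the sentence following it; the standing μ of
Corollary 4.20 runs over ‹all conjugate symplectic automorphic characters of A_E^× of weight one›, p0054 l. 73 –
p0055 l. 7, A_E^× restored across the page break) [display: over p2's accepted datum `S : Liu.AlbaneseH1Shape K c χEF`
(the datum of t6-p6's `Hyp.Liu2021_Cor4_20`, whose reading of d(μ, K) is reused verbatim): for every sufficiently
small level `L`, every two conjugate symplectic weight-one characters `μ`, `μ'` in one Gal(C/Q)-orbit (`S.galOrbit μ μ'`)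
and every two finite sets `T`, `T'` of admissible triples with first component `μ`, resp. `μ'`, EXHAUSTING the
classes ω(μ, ε, χ), resp. ω(μ', ε, χ), with non-zero `L`-invariants (the two clauses of `Liu.LiuCor420Shape`
verbatim), the integers `d(μ, L) = Liu.liuMultiplicity K S T L` and `d(μ', L) = Liu.liuMultiplicity K S T' L` are
equal — the printed sum over the pairs (ε, χ) read, as in t6-p6's display, as the sum over the distinct classes
ω(μ, ε, χ) (Thm. 4.18(2): mutually non-isomorphic), each counted once; `Gal(C/Q)`-orbits are the carried relation
`S.galOrbit` (p2's datum carries no Galois action, only its orbit relation). FAITHFUL for the asserted sentence in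
the carried vocabulary; the existence of exhausting sets is t6-p6's display, not asserted here. The displayed
sentence is an author's assertion in print («It is clear that …»), not a numbered theorem: whether it counts as a
«published theorem» in the sense of README §10.2 is the referees' call, stated here as the print has it]
[quote-audit: QA-t6lit-87 (t6-lit register, 2026-08-25T23:33:07Z, card C63 (a)): EXACT 6/6 on the layer quotes, the
7th (‹all conjugate symplectic … weight one›) EXACT-AS-RESTORED across the page break; locator finding F19 (the
sentence lies outside Corollary 4.20) applied in this docstring-only revision; the `def` is byte-identical to
p411620] -/
def Liu2021_Cor4_20_orbit (S : Liu.AlbaneseH1Shape K c χEF) : Prop :=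
  ∀ L : S.Level, S.IsSmall L →
    ∀ μ μ' : Liu.AutomorphicCharacter K,
      Liu.IsWeightOneConjugateSymplectic K c χEF μ → Liu.IsWeightOneConjugateSymplectic K c χEF μ' →
      S.galOrbit μ μ' →
      ∀ T T' : Finset (Liu.OscillatorTriple K c χEF),
        (∀ t ∈ T, t.μ = μ ∧ Liu.OscillatorTriple.IsAdmissible K t) →
        (∀ t : Liu.OscillatorTriple K c χEF, Liu.OscillatorTriple.IsAdmissible K t → t.μ = μ →
          0 < S.dimInv (S.osc t) L → S.osc t ∈ T.image S.osc) →
        (∀ t ∈ T', t.μ = μ' ∧ Liu.OscillatorTriple.IsAdmissible K t) →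
        (∀ t : Liu.OscillatorTriple K c χEF, Liu.OscillatorTriple.IsAdmissible K t → t.μ = μ' →
          0 < S.dimInv (S.osc t) L → S.osc t ∈ T'.image S.osc) →
        Liu.liuMultiplicity K S T L = Liu.liuMultiplicity K S T' L

#check @Liu2021_Cor4_20_orbit

end Summit.Ventures.HodgeRepro2.T6.Hyp
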